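import Literature.AlgebraicGeometry.Frobenioids.FrobenioidRealification
import Literature.AlgebraicGeometry.Frobenioids.UnitTrivializationFunctor
import Literature.AlgebraicGeometry.Frobenioids.DegreeModelFrobenioid
import Literature.AlgebraicGeometry.Frobenioids.ModelFrobenioidTypeBridge
import Mathlib.NumberTheory.Padics.PadicVal.Basic
import HarnessLib

/-!
# Frobenioids I, Proposition 5.3 ("Moreover", the `C^un-tr` half) as the INTERFACE-typed schema
# `Prop53_untr F FU BU` (FACT-LIST F-1096): the universal closure is false — a junk birationalization
# datum of `C^un-tr` over a GENUINE Frobenioid and THE unit-trivialization functor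

Mochizuki, *The geometry of Frobenioids I: the general theory*, Kyushu J. Math. **62** (2008)
293–400, §5, Proposition 5.3, kurims text p. 103: "Moreover, `C^un-tr`, `C^pf` are of model type, and
there are natural equivalences of categories `C^un-tr ⥲ …`, `C^pf ⥲ …`" [cite: MochizukiFrdI2008, Prop. 5.3 p.103].

PROOF-ONLY companion (cell abc-iut, block F fact-proving wave, seat abc-iut-f-025; FACT-LIST row
**F-1096** `PreFrobenioid.Prop53_untr`, labelled «universal-closure REFUTED / schema» by the R7 kernel
TYPE-audit of abc-iut-w5-d088 WITHOUT a kernel object for the refutation) of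
`FrobenioidRealification.lean` (seat abc-iut-L1-t5); same witness pattern as
`Thm51ivModelTypeSchemaNegative.lean` (F-1071).

The typed `Prop53_untr F FU BU := IsFrobenioid F → toUntr ⋙ FU = istrι ⋙ F → (IsOfPreModelType FU ∧
IsOfBiratFrobeniusNormalizedType BU) ∧ ∃ e : C^un-tr ≌ untrModel F, …` takes the birationalization datum
`BU : (ofFunctor Φ FU).BiratData` of `C^un-tr` as a FREE parameter (the data-only interface carries no
compatibility of Frobenius degrees).  Its universal closure is false at a GENUINE Frobenioid with THE
unit-trivialization functor: `F :=` abc-iut-L1-d4's model Frobenioid of `(pt, ℕ, 0, 0)`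
(`DegreeModel.hF`), `FU := untrFunctor hF` (abc-iut-L1's descent of `C^istr → F_Φ` to `C^un-tr`, for
which the factorisation `toUntr ⋙ FU = istrι ⋙ F` is the theorem `toUntr_comp_untrFunctor`), and the
junk datum `BU`: `(C^un-tr)^birat := C^un-tr`, `toBirat := 𝟭`, zero divisors, Frobenius degrees TWISTED to
the `2`-part `2^{v₂(k)}` of the genuine degree `k`.  At the class of the (isotropic) object `ι(−1)` the
images of the endomorphisms of genuine degrees `3` and `2` are, respectively, junk-linear and of junk
degree `2`, and Frobenius-normalization (Def. 1.2 (iv)) would demand `α² ∘ φ = φ ∘ α` — impossible, the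
genuine degrees being `18 ≠ 6` (read through `FU`, i.e. through `F` by `Quotient.lift_map_functor_map`):

* `DegreeModel.exists_junk_untrBiratData_not_biratFrobeniusNormalized` — the witness datum;
* `PreFrobenioid.not_forall_prop53_untr` — the universal closure (universe `0`) is FALSE (F-1096).

INSTANCE form (what consumers bind): `PreFrobenioid.prop53_untr_holds hF : Prop53_untr F (untrFunctor hF)
(biratData (isFrobenioid_untr hF) (hasBiratSquares_untr hF))` — Prop. 5.3 at THE constructions, PROVED for
every Frobenioid (`UnitTrivializationModelComparison.lean`).  So the row is admissible ONLY at that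
instance (R5).  Refuted-closure ≠ refuted-paper; no definitions; no statement of the paper is
strengthened; nothing here bears on [IUTchIII] Cor. 3.12.
-/

noncomputable section

namespace Literature.AlgebraicGeometry.Frobenioids

open CategoryTheory

namespace DegreeModel

/-- **A junk `BiratData` of `C^un-tr` against Prop. 5.3 as typed.**  Over the model Frobenioid `C` of
`(pt, ℕ, 0, 0)` and THE unit-trivialization functor `FU = untrFunctor hF : C^un-tr → F_Φ`, the datum
`(C^un-tr)^birat := C^un-tr`, `toBirat := 𝟭`, zero divisors, degrees `2^{v₂(k)}` is NOT of birationally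
Frobenius-normalized type: at the class of `ι(−1)` the images of the degree-`3` and degree-`2`
endomorphisms violate `α² ∘ φ = φ ∘ α` (genuine degrees `18 ≠ 6`). [cite: MochizukiFrdI2008, Def. 4.5 (i) p.86] -/
theorem exists_junk_untrBiratData_not_biratFrobeniusNormalized :
    ∃ BU : PreFrobenioidData.BiratData.{0, 0, 0, 0, 0, 0}
        (PreFrobenioidData.ofFunctor natΦ (PreFrobenioid.untrFunctor hF)),
      ¬ PreFrobenioidData.IsOfBiratFrobeniusNormalizedType BU := by
  let S₀ : PreFrobenioidData.{0} C D := PreFrobenioidData.ofFunctor natΦ F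
  let SU : PreFrobenioidData.{0} S₀.Untr D :=
    PreFrobenioidData.ofFunctor natΦ (PreFrobenioid.untrFunctor hF)
  have hiso : PreFrobenioid.IsOfIsotropicType F :=
    ModelFrobenioid.isOfIsotropicType objectwise_isGroupLike_B
  -- the `2`-part of a positive integer, as a monoid homomorphism `ℕ⁺ → ℕ⁺`
  let g : ℕ+ →* ℕ+ :=
    { toFun := fun k => ⟨2 ^ padicValNat 2 (k : ℕ), pow_pos two_pos _⟩
      map_one' := PNat.eq (by simp)
      map_mul' := fun a b => PNat.eq (by
        simp only [PNat.mul_coe, PNat.mk_coe]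
        rw [padicValNat.mul a.ne_zero b.ne_zero, pow_add]) }
  have hg3 : g 3 = 1 := PNat.eq (by
    show 2 ^ padicValNat 2 ((3 : ℕ+) : ℕ) = 1
    rw [padicValNat.eq_zero_of_not_dvd (by decide), pow_zero])
  have hg2 : ((g 2 : ℕ+) : ℕ) = 2 := by
    show 2 ^ padicValNat 2 ((2 : ℕ+) : ℕ) = 2
    rw [show ((2 : ℕ+) : ℕ) = 2 from rfl, padicValNat.self one_lt_two, pow_one]
  -- the junk operations on `C^un-tr`: zero divisors, degrees twisted by `g`
  let ops : PreFrobenioidData.{0} S₀.Untr D :=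
    { base := SU.base
      Mon := fun _ => PUnit
      pull := fun _ => MonoidHom.id _
      pull_id := fun _ _ => rfl
      pull_comp := fun _ _ _ => rfl
      div := fun _ => 1
      degFr := fun φ => g (SU.degFr φ)
      div_id := fun _ => rfl
      div_comp := fun _ _ => rfl
      degFr_id := fun A => by rw [SU.degFr_id, map_one]
      degFr_comp := fun ψ φ => by rw [SU.degFr_comp, map_mul] }
  let BU : PreFrobenioidData.BiratData.{0, 0, 0, 0, 0, 0} SU :=
    { Birat := S₀.Untr
      toBirat := 𝟭 _
      obj_surjective := fun X => ⟨X, rfl⟩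
      ops := ops
      ops_mon_eq_one := fun _ _ => rfl
      overBase := SU.base.leftUnitor
      phiBirat := fun _ => ⊤
      divBirat := fun _ => 1
      divBirat_mem := fun _ _ => Subgroup.mem_top _ }
  refine ⟨BU, fun h => ?_⟩
  -- the object `ι(−1)` of `C^istr` (every object is isotropic), its class in `C^un-tr`, and the images
  -- of its endomorphisms of degrees `3` and `2`
  let A₀ : S₀.Istr := ⟨ι (-1), (PreFrobenioidData.ofFunctor_isIsotropic F (ι (-1))).mpr (hiso (ι (-1)))⟩
  let X : S₀.Untr := S₀.toUntr.obj A₀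
  let α₀ : A₀ ⟶ A₀ := ObjectProperty.homMk (homOf (ι (-1)) (ι (-1)) 3 (by rw [dg_ι]; decide))
  let φ₀ : A₀ ⟶ A₀ := ObjectProperty.homMk (homOf (ι (-1)) (ι (-1)) 2 (by rw [dg_ι]; decide))
  let α : End X := S₀.toUntr.map α₀
  let φ : End X := S₀.toUntr.map φ₀
  -- genuine degrees through `FU` (`Quotient.lift_map_functor_map`)
  have hdα : SU.degFr α = 3 := rfl
  have hdφ : SU.degFr φ = 2 := rfl
  have hφ : ops.IsBaseIdentity φ := Subsingleton.elim _ _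
  have hα : α ∈ ops.endSubmonoid X := by
    refine ⟨Subsingleton.elim _ _, ?_⟩
    show g (SU.degFr α) = 1
    rw [hdα]; exact hg3
  have key := h.obj X φ hφ α hα
  -- `key : α ^ (ops.degFr φ) * φ = φ * α`; read off genuine Frobenius degrees through `SU.degFr`
  have key' : α ^ ((g (SU.degFr φ) : ℕ+) : ℕ) * φ = φ * α := key
  rw [hdφ, hg2, pow_two, End.mul_def, End.mul_def, End.mul_def] at key'
  have k' := congrArg SU.degFr key'
  rw [SU.degFr_comp, SU.degFr_comp, SU.degFr_comp, hdα, hdφ] at k'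
  exact absurd k' (by decide)

end DegreeModel

/-! ### The fully quantified closure, refuted at the model Frobenioid of `(pt, ℕ, 0, 0)` -/

/-- **FACT-LIST F-1096, universal closure REFUTED** (universe `0`; witness: `F` = the structure functor of
the model Frobenioid of `(pt, ℕ, 0, 0)`, `FU` = THE unit-trivialization functor `untrFunctor hF`, `BU` = the
junk datum of `DegreeModel.exists_junk_untrBiratData_not_biratFrobeniusNormalized`; both antecedents —
`IsFrobenioid F` and `toUntr ⋙ FU = istrι ⋙ F` — are DISCHARGED, by `DegreeModel.hF` and
`toUntr_comp_untrFunctor`).  The printed statement is the instance at THE constructions, PROVED for every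
Frobenioid (`PreFrobenioid.prop53_untr_holds`). [cite: MochizukiFrdI2008, Prop. 5.3 p.103] -/
theorem PreFrobenioid.not_forall_prop53_untr :
    ¬ ∀ (D : Type) [Category.{0} D] (Φ : Dᵒᵖ ⥤ CommMonCat.{0}) (C : Type) [Category.{0} C]
        (F : C ⥤ ElemFrobenioid Φ)
        (FU : (PreFrobenioidData.ofFunctor Φ F).Untr ⥤ ElemFrobenioid Φ)
        (BU : PreFrobenioidData.BiratData.{0, 0, 0, 0, 0, 0} (PreFrobenioidData.ofFunctor Φ FU)),
        Literature.AlgebraicGeometry.Frobenioids.PreFrobenioid.Prop53_untr F FU BU := by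
  intro h
  obtain ⟨BU, hBU⟩ := DegreeModel.exists_junk_untrBiratData_not_biratFrobeniusNormalized
  exact hBU (h _ _ _ DegreeModel.F (PreFrobenioid.untrFunctor DegreeModel.hF) BU DegreeModel.hF
    (PreFrobenioid.toUntr_comp_untrFunctor)).1.2

end Literature.AlgebraicGeometry.Frobenioids

end
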